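import Literature.NumberTheory.LFunctions.WeilTwoPrimeOddMarginKBase
import Literature.NumberTheory.LFunctions.WeilTwoPrimeOddMarginKDataP9
import Literature.NumberTheory.LFunctions.WeilBlockRowsP
import HarnessLib

/-!
# Two-prime odd-margin certificate K: the materialized block agrees with `P_r`, rows 52–64

`WeilCert.checkPmRow` (row `k` of the claim `Pm_{kl} = P_r(2k+1, 2l+1)`) for certificate K, by `decide +kernel`. Pure proof file; nothing is asserted.
-/

noncomputable section

namespace Literature.NumberTheory.LFunctions

set_option maxHeartbeats 0 in
/-- Row 52 of the materialized block is row 52 of `P_r` (certificate K). [folklore] -/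
theorem checkPmRow1_52_weilCert23K : weilCert23KBase.checkPmRow weilCert23KNu weilCert23KPm 1 52 = true := by
  decide +kernel

set_option maxHeartbeats 0 in
/-- Row 53 of the materialized block is row 53 of `P_r` (certificate K). [folklore] -/
theorem checkPmRow1_53_weilCert23K : weilCert23KBase.checkPmRow weilCert23KNu weilCert23KPm 1 53 = true := by
  decide +kernel

set_option maxHeartbeats 0 in
/-- Row 54 of the materialized block is row 54 of `P_r` (certificate K). [folklore] -/
theorem checkPmRow1_54_weilCert23K : weilCert23KBase.checkPmRow weilCert23KNu weilCert23KPm 1 54 = true := by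
  decide +kernel

set_option maxHeartbeats 0 in
/-- Row 55 of the materialized block is row 55 of `P_r` (certificate K). [folklore] -/
theorem checkPmRow1_55_weilCert23K : weilCert23KBase.checkPmRow weilCert23KNu weilCert23KPm 1 55 = true := by
  decide +kernel

set_option maxHeartbeats 0 in
/-- Row 56 of the materialized block is row 56 of `P_r` (certificate K). [folklore] -/
theorem checkPmRow1_56_weilCert23K : weilCert23KBase.checkPmRow weilCert23KNu weilCert23KPm 1 56 = true := by
  decide +kernel

set_option maxHeartbeats 0 in
/-- Row 57 of the materialized block is row 57 of `P_r` (certificate K). [folklore] -/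
theorem checkPmRow1_57_weilCert23K : weilCert23KBase.checkPmRow weilCert23KNu weilCert23KPm 1 57 = true := by
  decide +kernel

set_option maxHeartbeats 0 in
/-- Row 58 of the materialized block is row 58 of `P_r` (certificate K). [folklore] -/
theorem checkPmRow1_58_weilCert23K : weilCert23KBase.checkPmRow weilCert23KNu weilCert23KPm 1 58 = true := by
  decide +kernel

set_option maxHeartbeats 0 in
/-- Row 59 of the materialized block is row 59 of `P_r` (certificate K). [folklore] -/
theorem checkPmRow1_59_weilCert23K : weilCert23KBase.checkPmRow weilCert23KNu weilCert23KPm 1 59 = true := by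
  decide +kernel

set_option maxHeartbeats 0 in
/-- Row 60 of the materialized block is row 60 of `P_r` (certificate K). [folklore] -/
theorem checkPmRow1_60_weilCert23K : weilCert23KBase.checkPmRow weilCert23KNu weilCert23KPm 1 60 = true := by
  decide +kernel

set_option maxHeartbeats 0 in
/-- Row 61 of the materialized block is row 61 of `P_r` (certificate K). [folklore] -/
theorem checkPmRow1_61_weilCert23K : weilCert23KBase.checkPmRow weilCert23KNu weilCert23KPm 1 61 = true := by
  decide +kernel

set_option maxHeartbeats 0 in
/-- Row 62 of the materialized block is row 62 of `P_r` (certificate K). [folklore] -/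
theorem checkPmRow1_62_weilCert23K : weilCert23KBase.checkPmRow weilCert23KNu weilCert23KPm 1 62 = true := by
  decide +kernel

set_option maxHeartbeats 0 in
/-- Row 63 of the materialized block is row 63 of `P_r` (certificate K). [folklore] -/
theorem checkPmRow1_63_weilCert23K : weilCert23KBase.checkPmRow weilCert23KNu weilCert23KPm 1 63 = true := by
  decide +kernel

set_option maxHeartbeats 0 in
/-- Row 64 of the materialized block is row 64 of `P_r` (certificate K). [folklore] -/
theorem checkPmRow1_64_weilCert23K : weilCert23KBase.checkPmRow weilCert23KNu weilCert23KPm 1 64 = true := by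
  decide +kernel


end Literature.NumberTheory.LFunctions
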